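import Literature.Computability.Complexity.AdditiveRealClasses
import Literature.Computability.Complexity.CanonicalCodes
import Literature.Computability.Complexity.CodeFPBudgets
import Mathlib.Algebra.BigOperators.Fin
import HarnessLib

/-!
# The sign of an integer affine form at a rational point is decidable in `P` (`SignRat`)

Topic `Literature/Computability/Complexity`, grouping namespace `FKTransfer`. The last step of
Fournier–Koiran's proof of `NP⁰_ℝovs ⊆ P⁰_ℝovs(NP)` (ICALP 2000 = LIP RR-1999-21, Thm 3, p. 11:
"Another method consists in guessing a rational point `q ∈ P_S` with small coordinates … and then
running `T` on `⟨q, z⟩`") runs the real verifier on a RATIONAL point, i.e. answers its sign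
queries (integer affine forms `c + ∑ aᵢXᵢ`, `AdditiveRealClasses.affineQueryValue`) by exact
rational arithmetic. In the sign-oracle rendering this is the Boolean language

* `SignRat = {⟨r, q⟩ | 0 ≤ c·d + ∑ᵢ aᵢNᵢ}` where `r` decodes (by Mathlib's total decoder of
  `encodingIntBool.listBool`, value `decodeInts`) to `d :: N` and `q` to `c :: a` — for `d > 0` the
  sign of the form of `q` at the point `N/d` (`boolPair_ratCode_mem_SignRat`:
  `⟨ratCode d N, q⟩ ∈ SignRat ↔ 0 ≤ affineQueryValue (ratPoint d N) q`, and
  `ofLanguage_SignRat_ratCode`: the language oracle of `SignRat` on `⟨ratCode d N, ·⟩` IS the sign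
  oracle `signOracle (ratPoint d N)`);
* **`SignRat_mem_P`**: `SignRat ∈ P`. No machine is written: both strings are canonicalised by
  the tree's re-encoder `CanonCode.canonListFn CanonCode.canonIntFn = encode ∘ decode`
  (`CanonicalCodes.lean`), after which the test is a typed `CodeFP` program (`CodeFPArith.lean`:
  `intOfSM`, `intMul`, `intAdd`, `intLe`; `CodeFPBudgets.intSum`; `CodeFP.zipWith`) —
  `codeFP_sratTest`, `sratFn_apply`.

The point is that `affineQueryValue x q` depends on `q` only through its DECODED integer list,
missing coefficients counting `0` and excess ones being ignored; `sratVal` renders exactly this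
with `List.headD`/`List.zipWith` (`sum_zipWith_mul_eq`), so the equivalence holds for every query
string `q`, canonical or not — as it must, the verifier's queries being arbitrary strings.

## References

* H. Fournier, P. Koiran, *Lower bounds are not easier over the reals: inside PH*, ICALP 2000,
  LNCS 1853 = LIP RR-1999-21, Thm 3 and its proof, p. 11 (run `T` on a small rational point).
  [FournierKoiran2000]
* S. Arora, B. Barak, *Computational Complexity: A Modern Approach*, CUP 2009, §1.3 (polynomial
  time is closed under composition). [AroraBarak2009]
-/

namespace Literature.Computability.Complexity

namespace FKTransfer

open _root_.Computability Brick CodeFP Finset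

/-! ### Total decoding of integer-list codes -/

/-- The integer list read off ANY string by the (total) decoder of `encodingIntBool.listBool`.
[folklore] -/
noncomputable def decodeInts (w : List Bool) : List ℤ :=
  ((encodingIntBool.listBool).decode w).getD []

/-- The decoder of integer-list codes is total with value `decodeInts`, and the tree's re-encoder
`canonListFn canonIntFn` is `encode ∘ decodeInts`. [folklore] -/
theorem decode_eq_some_decodeInts (w : List Bool) :
    (encodingIntBool.listBool).decode w = some (decodeInts w) ∧
      CanonCode.canonListFn CanonCode.canonIntFn w = (encodingIntBool.listBool).encode (decodeInts w) := by
  have h := CanonCode.canonListFn_eq encodingIntBool CanonCode.decInt CanonCode.decode_int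
    CanonCode.canonIntFn_eq w
  have hd : decodeInts w = NegCNF.decList CanonCode.decInt (boolUnpair w).1.length (boolUnpair w).2 := by
    rw [decodeInts, h.1]; rfl
  rw [hd]
  exact h

/-- Decoding a genuine code. [folklore] -/
@[simp] theorem decodeInts_encode (l : List ℤ) : decodeInts ((encodingIntBool.listBool).encode l) = l := by
  rw [decodeInts, (encodingIntBool.listBool).decode_encode]; rfl

/-- The value of a sign query at a point, through `decodeInts`. [cite: FournierKoiran2000, §2 Remark 1] -/
theorem affineQueryValue_eq_decodeInts {n : ℕ} (x : Fin n → ℝ) (q : List Bool) :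
    affineQueryValue x q = ((decodeInts q).getD 0 0 : ℝ) +
      ∑ i : Fin n, (((decodeInts q).getD (i.val + 1) 0 : ℤ) : ℝ) * x i := by
  simp [affineQueryValue, (decode_eq_some_decodeInts q).1]

/-! ### The integer test -/

/-- The integer `c·d + ∑ᵢ aᵢNᵢ` for the point data `R = d :: N` and the form `L = c :: a` (missing
coefficients count `0`, excess ones are ignored: `List.headD`, `List.zipWith`). [folklore] -/
def sratVal (R L : List ℤ) : ℤ :=
  L.headD 0 * R.headD 0 + (List.zipWith (· * ·) L.tail R.tail).sum

/-- **The language `SignRat`**: pairs `⟨r, q⟩` whose decoded integer lists pass the test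
`0 ≤ sratVal`. [cite: FournierKoiran2000, Thm 3 (p. 11: run `T` on a rational point)] -/
def SignRat : Language Bool :=
  {w | 0 ≤ sratVal (decodeInts (fstF w)) (decodeInts (sndF w))}

/-- Membership of a pair in `SignRat`. [folklore] -/
theorem boolPair_mem_SignRat (r q : List Bool) :
    boolPair r q ∈ SignRat ↔ 0 ≤ sratVal (decodeInts r) (decodeInts q) := by
  change 0 ≤ sratVal (decodeInts (fstF (boolPair r q))) (decodeInts (sndF (boolPair r q))) ↔ _
  rw [fstF_boolPair, sndF_boolPair]

/-- `∑ (zipWith (·*·) A N) = ∑ᵢ A[i]·Nᵢ` over the indices of `N` (missing `A[i]` count `0`). [folklore] -/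
theorem sum_zipWith_mul_eq (A N : List ℤ) :
    (List.zipWith (· * ·) A N).sum = ∑ i : Fin N.length, A.getD i.val 0 * N.get i := by
  induction N generalizing A with
  | nil => simp
  | cons b N ih =>
    cases A with
    | nil => simp
    | cons a A =>
      rw [List.zipWith_cons_cons, List.sum_cons, ih A]
      show a * b + _ = ∑ i : Fin (N.length + 1), (a :: A).getD i.val 0 * (b :: N).get i
      rw [Fin.sum_univ_succ]
      simp

/-! ### `SignRat ∈ P` -/

/-- Integer-list codes as raw lists of the canonical integer code. [folklore] -/
theorem codeFP_intsOfList : CodeFP (listE smE) (rawE intE) (fun l : List ℤ => l) :=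
  ((map₀ intOfSM).comp (rawOfList smE)).congr fun l => by simp

/-- The head of a raw integer list with default `0`. [folklore] -/
theorem codeFP_headD_zero : CodeFP (rawE intE) intE (fun l : List ℤ => l.headD 0) := by
  have h0 : CodeFP (rawE intE) intE (fun _ => (0 : ℤ)) := const _ _
  exact (rawHeadOr intE).comp (h0.pair (CodeFP.id (rawE intE)))

/-- Pointwise products of two raw integer lists. [folklore] -/
theorem codeFP_zipMul :
    CodeFP (pairE (rawE intE) (rawE intE)) (rawE intE) (fun p => List.zipWith (· * ·) p.1 p.2) := by
  have hg : CodeFP (pairE unitE (pairE intE intE)) intE (fun t => t.2.1 * t.2.2) :=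
    intMul.comp (snd unitE (pairE intE intE))
  have hz : CodeFP (pairE unitE (pairE (rawE intE) (rawE intE))) (rawE intE)
      (fun p => List.zipWith (fun a b => a * b) p.2.1 p.2.2) :=
    zipWith (g := fun t : Unit × ℤ × ℤ => t.2.1 * t.2.2) hg
  have hu : CodeFP (pairE (rawE intE) (rawE intE)) (pairE unitE (pairE (rawE intE) (rawE intE)))
      (fun p => ((), p)) := by
    have hc : CodeFP (pairE (rawE intE) (rawE intE)) unitE (fun _ => ()) := const _ _
    exact hc.pair (CodeFP.id _)
  exact hz.comp hu

/-- **The test `0 ≤ sratVal R L` is a typed polynomial-time program** on the pair of list codes.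
[cite: AroraBarak2009, §1.3] -/
theorem codeFP_sratTest :
    CodeFP (pairE (listE smE) (listE smE)) bitE (fun p : List ℤ × List ℤ => decide (0 ≤ sratVal p.1 p.2)) := by
  have hR : CodeFP (pairE (listE smE) (listE smE)) (rawE intE) (fun p => p.1) :=
    codeFP_intsOfList.comp (fst _ _)
  have hL : CodeFP (pairE (listE smE) (listE smE)) (rawE intE) (fun p => p.2) :=
    codeFP_intsOfList.comp (snd _ _)
  -- each combinator term is elaborated on its own (`( … :)`) and only then compared with the
  -- stated map: elaborating against the expected type makes the unifier unfold the arithmetic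
  have hprod : CodeFP (pairE (listE smE) (listE smE)) intE (fun p => p.2.headD 0 * p.1.headD 0) :=
    (intMul.comp ((codeFP_headD_zero.comp hL).pair (codeFP_headD_zero.comp hR)) :)
  have hsum : CodeFP (pairE (listE smE) (listE smE)) intE
      (fun p => (List.zipWith (· * ·) p.2.tail p.1.tail).sum) :=
    (intSum.comp (codeFP_zipMul.comp (((rawTail intE).comp hL).pair ((rawTail intE).comp hR))) :)
  have h0 : CodeFP (pairE (listE smE) (listE smE)) intE (fun _ => (0 : ℤ)) := const _ _
  have hv : CodeFP (pairE (listE smE) (listE smE)) intE (fun p => sratVal p.1 p.2) :=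
    (intAdd.comp (hprod.pair hsum) :)
  exact (intLe.comp (h0.pair hv) :)

/-- The canonicaliser of integer-list codes. [folklore] -/
noncomputable def canonQ : List Bool → List Bool :=
  CanonCode.canonListFn CanonCode.canonIntFn

/-- `canonQ ∈ FP`. [folklore] -/
theorem canonQ_mem_FP : canonQ ∈ FP :=
  CanonCode.canonListFn_mem_FP CanonCode.canonIntFn_mem_FP CanonCode.length_canonIntFn_le

/-- `canonQ w` is the genuine code of `decodeInts w`. [folklore] -/
theorem canonQ_apply (w : List Bool) : canonQ w = listE smE (decodeInts w) := by
  rw [canonQ, (decode_eq_some_decodeInts w).2, listE_eq]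
  rfl

/-- The `FP` string function chosen by `codeFP_sratTest`. [folklore] -/
noncomputable def sratProg : List Bool → List Bool :=
  Classical.choose codeFP_sratTest

/-- Its specification. [folklore] -/
theorem sratProg_spec : sratProg ∈ FP ∧ ∀ p : List ℤ × List ℤ,
    sratProg (pairE (listE smE) (listE smE) p) = bitE (decide (0 ≤ sratVal p.1 p.2)) :=
  Classical.choose_spec codeFP_sratTest

/-- **The decider of `SignRat`**: canonicalise both components, run the typed test, keep the head
bit. [cite: FournierKoiran2000, Thm 3 (p. 11)] -/
noncomputable def sratFn : List Bool → List Bool :=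
  HashBricks.headBitFn ∘ sratProg ∘ fanoutFn (canonQ ∘ fstF) (canonQ ∘ sndF)

/-- `sratFn ∈ FP`. [cite: AroraBarak2009, §1.3] -/
theorem sratFn_mem_FP : sratFn ∈ FP :=
  comp_mem_FP HashBricks.headBitFn_mem_FP (comp_mem_FP sratProg_spec.1
    (fanoutFn_mem_FP (comp_mem_FP canonQ_mem_FP fstF_mem_FP) (comp_mem_FP canonQ_mem_FP sndF_mem_FP)))

/-- **Value of the decider on every string.** [folklore] -/
theorem sratFn_apply (w : List Bool) :
    sratFn w = [decide (0 ≤ sratVal (decodeInts (fstF w)) (decodeInts (sndF w)))] := by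
  have h := sratProg_spec.2 (decodeInts (fstF w), decodeInts (sndF w))
  simp only [pairE_apply] at h
  rw [sratFn, Function.comp_apply, Function.comp_apply, fanoutFn_apply, Function.comp_apply,
    Function.comp_apply, canonQ_apply, canonQ_apply, h, HashBricks.headBitFn_apply]
  rfl

/-- **`SignRat ∈ P`.** [cite: FournierKoiran2000, Thm 3 (p. 11: "running `T` on `⟨q, z⟩`" is a polynomial-time computation)] -/
theorem SignRat_mem_P : SignRat ∈ Classes.P :=
  mem_P_of_mem_FP sratFn_mem_FP SignRat fun w =>
    ⟨fun h => by
      have h' : 0 ≤ sratVal (decodeInts (fstF w)) (decodeInts (sndF w)) := h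
      rw [sratFn_apply, decide_eq_true h'],
     fun h => by
      have h' : ¬ 0 ≤ sratVal (decodeInts (fstF w)) (decodeInts (sndF w)) := h
      rw [sratFn_apply, decide_eq_false h']⟩

/-! ### Semantics: the sign oracle of a rational point -/

/-- The rational point `N/d ∈ ℝ^{|N|}`. [cite: FournierKoiran2000, Thm 3 (p. 11: a rational point with small coordinates)] -/
noncomputable def ratPoint (d : ℕ) (N : List ℤ) : Fin N.length → ℝ :=
  fun i => (N.get i : ℝ) / d

/-- The code of the rational point `N/d`: the integer-list code of `d :: N`. [folklore] -/
def ratCode (d : ℕ) (N : List ℤ) : List Bool :=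
  (encodingIntBool.listBool).encode ((d : ℤ) :: N)

/-- Decoding the code of a rational point. [folklore] -/
@[simp] theorem decodeInts_ratCode (d : ℕ) (N : List ℤ) : decodeInts (ratCode d N) = (d : ℤ) :: N :=
  decodeInts_encode _

/-- `sratVal (d :: N) L = c·d + ∑ᵢ aᵢNᵢ` with `c = L[0]`, `aᵢ = L[i+1]` (default `0`). [folklore] -/
theorem sratVal_cons (d : ℤ) (N L : List ℤ) :
    sratVal (d :: N) L = L.getD 0 0 * d + ∑ i : Fin N.length, L.getD (i.val + 1) 0 * N.get i := by
  rw [sratVal, List.headD_cons, List.tail_cons, sum_zipWith_mul_eq]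
  congr 1
  · cases L <;> simp
  · exact Finset.sum_congr rfl fun i _ => by cases L <;> simp

/-- **`SignRat` on `⟨ratCode d N, q⟩` is the sign of the form of `q` at `N/d`** (`d > 0`), for
every query string `q`. [cite: FournierKoiran2000, Thm 3 (p. 11)] -/
theorem boolPair_ratCode_mem_SignRat {d : ℕ} (hd : 0 < d) (N : List ℤ) (q : List Bool) :
    boolPair (ratCode d N) q ∈ SignRat ↔ (0 : ℝ) ≤ affineQueryValue (ratPoint d N) q := by
  rw [boolPair_mem_SignRat, decodeInts_ratCode, sratVal_cons, affineQueryValue_eq_decodeInts]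
  set L := decodeInts q
  have hdR : (0 : ℝ) < d := by exact_mod_cast hd
  have key : ((L.getD 0 0 * (d : ℤ) + ∑ i : Fin N.length, L.getD (i.val + 1) 0 * N.get i : ℤ) : ℝ) =
      (d : ℝ) * ((L.getD 0 0 : ℝ) + ∑ i : Fin N.length, ((L.getD (i.val + 1) 0 : ℤ) : ℝ) * ratPoint d N i) := by
    push_cast
    rw [mul_add, Finset.mul_sum]
    congr 1
    · ring
    · refine Finset.sum_congr rfl fun i _ => ?_
      rw [ratPoint]
      field_simp
  constructor
  · intro h
    have h1 : (d : ℝ) * 0 ≤ (d : ℝ) * ((L.getD 0 0 : ℝ) +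
        ∑ i : Fin N.length, ((L.getD (i.val + 1) 0 : ℤ) : ℝ) * ratPoint d N i) := by
      rw [mul_zero, ← key]
      exact_mod_cast h
    exact le_of_mul_le_mul_left h1 hdR
  · intro h
    have h2 : (0 : ℝ) ≤ ((L.getD 0 0 * (d : ℤ) + ∑ i : Fin N.length, L.getD (i.val + 1) 0 * N.get i : ℤ) : ℝ) := by
      rw [key]
      exact mul_nonneg hdR.le h
    exact_mod_cast h2

/-- **The language oracle of `SignRat`, queried on `⟨ratCode d N, q⟩`, is the sign oracle of the
rational point `N/d`.** [cite: FournierKoiran2000, Thm 3 (p. 11)] -/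
theorem ofLanguage_SignRat_ratCode {d : ℕ} (hd : 0 < d) (N : List ℤ) (q : List Bool) :
    Oracle.ofLanguage SignRat (boolPair (ratCode d N) q) = signOracle (ratPoint d N) q := by
  rw [Oracle.ofLanguage_apply, signOracle_apply]
  congr 1
  by_cases h : (0 : ℝ) ≤ affineQueryValue (ratPoint d N) q
  · rw [(Set.mem_iff_boolIndicator _ _).1 ((boolPair_ratCode_mem_SignRat hd N q).2 h), decide_eq_true h]
  · rw [(Set.notMem_iff_boolIndicator _ _).1 (fun h' => h ((boolPair_ratCode_mem_SignRat hd N q).1 h')),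
      decide_eq_false h]

end FKTransfer

end Literature.Computability.Complexity
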